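import Summits.ResolutionOfSingularities.ResolutionOfSingularities.Theorems.WeightedInvariantContactCylinderTransport
import Summits.ResolutionOfSingularities.ResolutionOfSingularities.Theorems.WeightedInvariantHypersurfaceLocalGameEFT4SDimOneGame
import HarnessLib

/-!
# `iotaCylinder ι₀ ι` — the ι-twin of the cylinder construction: READ A LATER LETTER AT THE GENERIC POINT OF THE EARLIER
# LETTERS' TOP STRATUM (door `HypersurfaceCentreConstruction`, stmt-ResolutionOfSingularities-19897; KEY `stub_localWeightedDropEFT4S`,
# P3 rung `stub_keyRung_dimLEThree` of skeleton v3.7 / ladder `PRung d` p522114; res-type-061, OFFER (o29-c) 2026-08-27T11:23:18Z)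

Topic: `Summits/ResolutionOfSingularities/ResolutionOfSingularities/Theorems`. DEFINITIONS posited by the route `WeightedInvariant` for the
door item `HypersurfaceCentreConstruction` — objects OF THE LINE, not cited statements (`--supports stmt-ResolutionOfSingularities-19897 --as
helper`).  Given an "earlier" invariant `ι₀` and a "later" letter `ι` (both in the binder shape `(R : Type) → [CommRing R] → R → Ordinal`
of the clauses of `…HypersurfaceLocalGameEFT3`), `iotaCylinder ι₀ ι R f` is `ι` READ IN `R_P` AT `f/1`, `P = topStratumPrime ι₀ R f` the
generic prime of the top `ι₀`-stratum through the closed point (res-type-005's `ContactCylinder.topStratum`/`topStratumPrime`, p524206),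
whenever that stratum is irreducible; pointwise (`ι R f`) otherwise.  This is the combinator behind the «CYLINDER-WISE reading of the
quantitative letter when the equimultiple locus is a permissible curve» (res-type-073 IOTA3-PROBE §3 (2); res-type-005 (D1) premise;
ORDER (o32-ι-c) of res-L1-w43-plan-1): at an ISOLATED top point `P = 𝔪` and the reading is pointwise (`iotaCylinder_eq_self_of_topStratumPrime_eq_maximalIdeal`),
along a permissible curve `V(P)` it is the TRANSVERSAL reading in the surface germ `R_P`.  Parametric, no letters fixed; the two TRANSPORT clauses
(c6) `IotaIsoInvariant` / (c12a) `IotaUnitInvariant` of `PRung d` pass to `iotaCylinder ι₀ ι` from those of `ι₀`, `ι` (this file, over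
res-type-061's p527090 transport lemmas).  The `…On`-shaped obligations (c7)/(c8)/(c10)/(c11) of the later letters are NOT touched here.

[OURS · L1 W4.3 · (o29-c); nothing here asserts anything about Hironaka's problem; NOT a statement of the manuscript under review (Hironaka 2017,
[claim: Hironaka2017, status: under-review]); AI work, weaker than expert review.]

## References
* V. Cossart, U. Jannsen, S. Saito, LNM 2270 (2020), Ch. 8 (invariants of the transversal surface germ along a permissible curve). [CossartJannsenSaito2020]
-/

noncomputable section

open IsLocalRing
open Summit.ResolutionOfSingularities.ResolutionOfSingularities.Cruxes.HypersurfaceCentreConstruction.LocalEngine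

set_option linter.dupNamespace false -- mandated namespace of this single-conjunct summit

namespace Summit.ResolutionOfSingularities.ResolutionOfSingularities.Theorems

namespace ContactCylinder

/-! ## Definitions -/

/-- [OURS · (o29-c)] **`ι` read at a prime**: `iotaAtPrime ι R P f = ι (R_P) (f/1)`. A predicate-free abbreviation of the line, not a
cited statement. -/
def iotaAtPrime (ι : (R : Type) → [CommRing R] → R → Ordinal.{0}) (R : Type) [CommRing R] (P : Ideal R) [P.IsPrime] (f : R) :
    Ordinal.{0} :=
  ι (Localization.AtPrime P) (algebraMap R (Localization.AtPrime P) f)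

open Classical in
/-- [OURS · (o29-c) · candidate combinator] **THE ι-CYLINDER `iotaCylinder ι₀ ι`**: the later letter `ι` READ AT THE GENERIC POINT of the top
`ι₀`-stratum through the closed point — `ι (R_P) (f/1)` for `P = topStratumPrime ι₀ R f` when `P` is prime (irreducible stratum: regimes P≤2 /
P3a, and every isolated top point), and the pointwise value `ι R f` otherwise (junk).  Design use (IOTA3-DESIGN of res-L1-w43-plan-1):
`ι₃ = iotaLex _ ι₀ (iotaCylinder ι₀ σ)` with `ι₀ = (iotaOrd, ε)` and `σ` the quantitative contact letter. -/
def iotaCylinder (ι₀ ι : (R : Type) → [CommRing R] → R → Ordinal.{0}) (R : Type) [CommRing R] (f : R) : Ordinal.{0} :=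
  if h : (topStratumPrime ι₀ R f).IsPrime then @iotaAtPrime ι R _ (topStratumPrime ι₀ R f) h f else ι R f

/-! ## Unfolding and congruence -/

section Unfold

variable (ι₀ ι : (R : Type) → [CommRing R] → R → Ordinal.{0})

/-- `iotaAtPrime` unfolded. [folklore] -/
theorem iotaAtPrime_def (R : Type) [CommRing R] (P : Ideal R) [P.IsPrime] (f : R) :
    iotaAtPrime ι R P f = ι (Localization.AtPrime P) (algebraMap R (Localization.AtPrime P) f) :=
  rfl

/-- `iotaAtPrime` does not depend on the primality witness nor on the name of the prime. [folklore] -/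
theorem iotaAtPrime_congr (R : Type) [CommRing R] {P Q : Ideal R} [P.IsPrime] [Q.IsPrime] (h : P = Q) (f : R) :
    iotaAtPrime ι R P f = iotaAtPrime ι R Q f := by
  subst h
  rfl

open Classical in
/-- `iotaCylinder ι₀ ι R f` only depends on the generic prime of the top `ι₀`-stratum. [folklore] -/
theorem iotaCylinder_eq_dite (R : Type) [CommRing R] (f : R) {P : Ideal R} (hP : topStratumPrime ι₀ R f = P) :
    iotaCylinder ι₀ ι R f = if h : P.IsPrime then @iotaAtPrime ι R _ P h f else ι R f := by
  subst hP
  rfl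

/-- On an irreducible top `ι₀`-stratum, `iotaCylinder ι₀ ι R f = ι (R_P) (f/1)`, `P` its generic prime. [folklore] -/
theorem iotaCylinder_eq_iotaAtPrime (R : Type) [CommRing R] (f : R) [h : (topStratumPrime ι₀ R f).IsPrime] :
    iotaCylinder ι₀ ι R f = iotaAtPrime ι R (topStratumPrime ι₀ R f) f := by
  unfold iotaCylinder
  rw [dif_pos h]

/-- Off the irreducible strata the reading is pointwise: `iotaCylinder ι₀ ι R f = ι R f` (junk). [folklore] -/
theorem iotaCylinder_of_not_isPrime (R : Type) [CommRing R] (f : R) (h : ¬ (topStratumPrime ι₀ R f).IsPrime) :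
    iotaCylinder ι₀ ι R f = ι R f := by
  unfold iotaCylinder
  rw [dif_neg h]

/-- **The value when the top `ι₀`-stratum is `V(P)`**: `iotaCylinder ι₀ ι R f = ι (R_P) (f/1)` — the TRANSVERSAL reading along a
permissible centre `V(P)`. [folklore] -/
theorem iotaCylinder_eq_of_topStratum_eq (R : Type) [CommRing R] (f : R) {P : Ideal R} [hP : P.IsPrime]
    (hE : topStratum ι₀ R f = {𝔮 | P ≤ 𝔮.asIdeal}) :
    iotaCylinder ι₀ ι R f = ι (Localization.AtPrime P) (algebraMap R (Localization.AtPrime P) f) := by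
  have hPeq : topStratumPrime ι₀ R f = P := topStratumPrime_eq_of_topStratum_eq ι₀ R f hE
  rw [iotaCylinder_eq_dite ι₀ ι R f hPeq, dif_pos hP]
  rfl

/-- **At an ISOLATED top point the reading is pointwise**: if the generic prime of the top `ι₀`-stratum of a local ring `R` is `𝔪`, then
`iotaCylinder ι₀ ι R f = ι R f` for an iso-invariant `ι` (`R_𝔪 ≅ R`; 005's `iota_localization_maximalIdeal_eq`). [folklore] -/
theorem iotaCylinder_eq_self_of_topStratumPrime_eq_maximalIdeal (hι : IotaIsoInvariant ι) (R : Type) [CommRing R] [IsLocalRing R]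
    (f : R) (h : topStratumPrime ι₀ R f = maximalIdeal R) : iotaCylinder ι₀ ι R f = ι R f := by
  rw [iotaCylinder_eq_dite ι₀ ι R f h, dif_pos (inferInstance : (maximalIdeal R).IsPrime), iotaAtPrime_def]
  exact LocalGameEFT4SDimOne.iota_localization_maximalIdeal_eq ι hι f

/-- … in particular when the top `ι₀`-stratum of a local ring is the closed point alone. [folklore] -/
theorem iotaCylinder_eq_self_of_topStratum_eq_closedPoint (hι : IotaIsoInvariant ι) (R : Type) [CommRing R] [IsLocalRing R]
    (f : R) (hE : topStratum ι₀ R f = {𝔮 | maximalIdeal R ≤ 𝔮.asIdeal}) : iotaCylinder ι₀ ι R f = ι R f :=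
  iotaCylinder_eq_self_of_topStratumPrime_eq_maximalIdeal ι₀ ι hι R f (topStratumPrime_eq_of_topStratum_eq ι₀ R f hE)

end Unfold

/-! ## Transport: unit invariance -/

section Unit

variable (ι₀ ι : (R : Type) → [CommRing R] → R → Ordinal.{0})

/-- `iotaAtPrime` over a fixed prime is unit-invariant when `ι` is (`v/1` is a unit). [folklore] -/
theorem iotaAtPrime_unit_mul (hι : IotaUnitInvariant ι) (R : Type) [CommRing R] (P : Ideal R) [P.IsPrime] {v : R} (hv : IsUnit v)
    (f : R) : iotaAtPrime ι R P (v * f) = iotaAtPrime ι R P f := by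
  rw [iotaAtPrime_def, iotaAtPrime_def, map_mul, hι _ _ _ (hv.map _)]

/-- **`iotaCylinder ι₀ ι` is unit-invariant** as soon as `ι₀` and `ι` are: the clause `IotaUnitInvariant (iotaCylinder ι₀ ι)` of `PRung d`.
[OURS · L1 W4.3 · (o29-c)] -/
theorem iotaCylinder_unitInvariant (h₀ : IotaUnitInvariant ι₀) (hι : IotaUnitInvariant ι) : IotaUnitInvariant (iotaCylinder ι₀ ι) := by
  intro R _ v g hv
  have hP : topStratumPrime ι₀ R (v * g) = topStratumPrime ι₀ R g := topStratumPrime_unit_mul ι₀ h₀ R hv g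
  rw [iotaCylinder_eq_dite ι₀ ι R (v * g) hP, iotaCylinder_eq_dite ι₀ ι R g rfl]
  by_cases h : (topStratumPrime ι₀ R g).IsPrime
  · rw [dif_pos h, dif_pos h]
    exact iotaAtPrime_unit_mul ι hι R _ hv g
  · rw [dif_neg h, dif_neg h]
    exact hι R v g hv

end Unit

/-! ## Transport: iso invariance -/

section Iso

variable (ι₀ ι : (R : Type) → [CommRing R] → R → Ordinal.{0})
variable {R T : Type} [CommRing R] [CommRing T] (e : R ≃+* T)

/-- **`iotaAtPrime` is transported by a ring isomorphism**: for `Q` a prime of `T`, `iotaAtPrime ι T Q (e f) = iotaAtPrime ι R (e⁻¹Q) f`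
(`R_{e⁻¹Q} ≃+* T_Q`, res-type-061's `ringEquivOfRingEquiv_atPrime_apply`). [folklore] -/
theorem iotaAtPrime_ringEquiv (hι : IotaIsoInvariant ι) (Q : Ideal T) [Q.IsPrime] (f : R) :
    iotaAtPrime ι T Q (e f) = iotaAtPrime ι R (Q.comap (e : R →+* T)) f := by
  rw [iotaAtPrime_def, iotaAtPrime_def, ← ringEquivOfRingEquiv_atPrime_apply e Q f,
    hι _ _ (IsLocalization.ringEquivOfRingEquiv (M := (Q.comap (e : R →+* T)).primeCompl) (T := Q.primeCompl)
      (Localization.AtPrime (Q.comap (e : R →+* T))) (Localization.AtPrime Q) e (primeCompl_comap_map_ringEquiv e Q))]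

/-- **`iotaCylinder ι₀ ι` is iso-invariant** as soon as `ι₀` and `ι` are: the clause `IotaIsoInvariant (iotaCylinder ι₀ ι)` of `PRung d`.
[OURS · L1 W4.3 · (o29-c)] -/
theorem iotaCylinder_isoInvariant (h₀ : IotaIsoInvariant ι₀) (hι : IotaIsoInvariant ι) : IotaIsoInvariant (iotaCylinder ι₀ ι) := by
  intro R T _ _ e g
  have hP : topStratumPrime ι₀ T (e g) = (topStratumPrime ι₀ R g).comap (e.symm : T →+* R) := topStratumPrime_ringEquiv ι₀ e h₀ g
  rw [iotaCylinder_eq_dite ι₀ ι T (e g) hP, iotaCylinder_eq_dite ι₀ ι R g rfl]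
  by_cases h : (topStratumPrime ι₀ R g).IsPrime
  · haveI : ((topStratumPrime ι₀ R g).comap (e.symm : T →+* R)).IsPrime := Ideal.comap_isPrime _ _
    rw [dif_pos this, dif_pos h, iotaAtPrime_ringEquiv ι e hι _ g]
    have hQ : ((topStratumPrime ι₀ R g).comap (e.symm : T →+* R)).comap (e : R →+* T) = topStratumPrime ι₀ R g := by
      ext r
      simp only [Ideal.mem_comap, RingHom.coe_coe, RingEquiv.symm_apply_apply]
    exact iotaAtPrime_congr ι R hQ g
  · have h' : ¬ ((topStratumPrime ι₀ R g).comap (e.symm : T →+* R)).IsPrime := by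
      intro hc
      apply h
      have hQ : ((topStratumPrime ι₀ R g).comap (e.symm : T →+* R)).comap (e : R →+* T) = topStratumPrime ι₀ R g := by
        ext r
        simp only [Ideal.mem_comap, RingHom.coe_coe, RingEquiv.symm_apply_apply]
      rw [← hQ]
      exact Ideal.comap_isPrime _ _
    rw [dif_neg h', dif_neg h]
    exact hι R T e g

end Iso

end ContactCylinder

end Summit.ResolutionOfSingularities.ResolutionOfSingularities.Theorems

end
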